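import Summits.KontsevichZagierPeriods.KontsevichZagierPeriods.Theses.SpheresForWalls

/-!
# `Assembly` (stmt-KontsevichZagierPeriods-16403, route SpheresForWalls) — proof

The route's assembly item
`SpinNormalForm → PiCancellation → RationalSphereLayer → SphericalKernel →
KontsevichZagierPeriods`
is its deciding theorem `closes` read as an implication. (lead c10 of crux 9129, banking)
-/

namespace Summit.KontsevichZagierPeriods.SpheresForWalls

/-- **Assembly of route SpheresForWalls** (stmt-KontsevichZagierPeriods-16403):
`SpinNormalForm → PiCancellation → RationalSphereLayer → SphericalKernel →
KontsevichZagierPeriods`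
— the cruxes imply the summit, by the route's deciding theorem `closes`.
[Kontsevich–Zagier 2001, §1.2] [folklore] -/
theorem assembly_proof :
    Summit.KontsevichZagierPeriods.KontsevichZagierPeriods.Theses.SpheresForWalls.Assembly :=
  Summit.KontsevichZagierPeriods.KontsevichZagierPeriods.Theses.SpheresForWalls.closes

end Summit.KontsevichZagierPeriods.SpheresForWalls
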